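import Mathlib
import Summits.AtomisticToContinuum.Crystallization.Theorems.ChessboardParticlePlanesLjLaminarWindowsGlueC5
import HarnessLib

/-! # Core extraction (k-core peeling of the shell graph) — stub `stub_coreExtraction` of line `Sketch` (skeleton rev. 11, lead c6), crux `LjLaminarWindows` (stmt-AtomisticToContinuum-6711) -/

noncomputable section

open scoped BigOperators
open Filter Topology
open Literature.MathematicalPhysics.StatisticalMechanics
open Summit.AtomisticToContinuum.Crystallization.Theorems.ChargedEnergyGapNegative

namespace Summit.AtomisticToContinuum.Crystallization.Theorems.LjLaminarWindowsSketch

/-- **Generic `θ`-core peeling.** For a symmetric decidable relation `r` on a finite set `S`, real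
weights `w` and a real `θ`, there is `Y ⊆ S` in which every element `p` has more than `θ · w p`
partners inside `Y`, while the ordered `r`-pairs of `S × S` number at most those of `Y × Y` plus
`2 θ ∑_{p ∈ S \ Y} w p` (delete violators one at a time; each deletion loses at most `θ w p` pairs in
each order). [folklore] -/
theorem coreExtraction_peel {α : Type*} [DecidableEq α] (r : α → α → Prop) [DecidableRel r]
    (hr : ∀ a b, r a b → r b a) (w : α → ℝ) (θ : ℝ) :
    ∀ (n : ℕ) (S : Finset α), S.card = n → ∃ Y ⊆ S,
      (∀ p ∈ Y, θ * w p < ((Y.filter fun q => r q p).card : ℝ)) ∧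
      (((S ×ˢ S).filter fun e : α × α => r e.1 e.2).card : ℝ) ≤
        (((Y ×ˢ Y).filter fun e : α × α => r e.1 e.2).card : ℝ) + 2 * θ * ∑ p ∈ S \ Y, w p := by
  intro n
  induction n with
  | zero =>
    intro S hS
    refine ⟨S, subset_rfl, ?_, by simp⟩
    intro p hp
    rw [Finset.card_eq_zero] at hS
    simp [hS] at hp
  | succ n ih =>
    intro S hS
    by_cases hgood : ∀ p ∈ S, θ * w p < ((S.filter fun q => r q p).card : ℝ)
    · exact ⟨S, subset_rfl, hgood, by simp⟩
    push Not at hgood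
    obtain ⟨p₀, hp₀, hv⟩ := hgood
    have hS' : (S.erase p₀).card = n := by
      rw [Finset.card_erase_of_mem hp₀, hS]
      rfl
    obtain ⟨Y, hYS', hYa, hYb⟩ := ih (S.erase p₀) hS'
    have hp₀Y : p₀ ∉ Y := fun h => Finset.notMem_erase p₀ S (hYS' h)
    refine ⟨Y, hYS'.trans (Finset.erase_subset _ _), hYa, ?_⟩
    -- every ordered pair of `S × S` avoids `p₀` in both coordinates or has it first or second
    have hsub : (S ×ˢ S).filter (fun e : α × α => r e.1 e.2) ⊆
        ((S.erase p₀) ×ˢ (S.erase p₀)).filter (fun e : α × α => r e.1 e.2) ∪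
          ((({p₀} : Finset α) ×ˢ S).filter (fun e : α × α => r e.1 e.2) ∪
            (S ×ˢ ({p₀} : Finset α)).filter (fun e : α × α => r e.1 e.2)) := by
      intro e he
      simp only [Finset.mem_union, Finset.mem_filter, Finset.mem_product, Finset.mem_erase,
        Finset.mem_singleton] at he ⊢
      obtain ⟨⟨h1, h2⟩, hre⟩ := he
      by_cases ha : e.1 = p₀
      · exact Or.inr (Or.inl ⟨⟨ha, h2⟩, hre⟩)
      · by_cases hb : e.2 = p₀
        · exact Or.inr (Or.inr ⟨⟨h1, hb⟩, hre⟩)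
        · exact Or.inl ⟨⟨⟨ha, h1⟩, ⟨hb, h2⟩⟩, hre⟩
    -- pairs with `p₀` first: counted by the partners of `p₀` (symmetry of `r`)
    have h1 : ((({p₀} : Finset α) ×ˢ S).filter (fun e : α × α => r e.1 e.2)).card =
        (S.filter fun q => r q p₀).card := by
      rw [Finset.card_filter, Finset.sum_product, Finset.sum_singleton, Finset.card_filter]
      refine Finset.sum_congr rfl fun q _ => ?_
      have hiff : r p₀ q ↔ r q p₀ := ⟨hr _ _, hr _ _⟩
      simp only [hiff]
    -- pairs with `p₀` second: the partners of `p₀`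
    have h2 : ((S ×ˢ ({p₀} : Finset α)).filter (fun e : α × α => r e.1 e.2)).card =
        (S.filter fun q => r q p₀).card := by
      rw [Finset.card_filter, Finset.sum_product_right, Finset.sum_singleton, Finset.card_filter]
    have hcnt : (((S ×ˢ S).filter fun e : α × α => r e.1 e.2).card : ℝ) ≤
        ((((S.erase p₀) ×ˢ (S.erase p₀)).filter fun e : α × α => r e.1 e.2).card : ℝ) +
          2 * ((S.filter fun q => r q p₀).card : ℝ) := by
      have hnat := (Finset.card_le_card hsub).trans ((Finset.card_union_le _ _).trans
        (Nat.add_le_add_left (Finset.card_union_le _ _) _))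
      rw [h1, h2] at hnat
      have hreal := (Nat.cast_le (α := ℝ)).mpr hnat
      push_cast at hreal
      linarith
    -- the discarded weights: `S \ Y = (S.erase p₀ \ Y) ∪ {p₀}`
    have hsum : ∑ p ∈ S \ Y, w p = ∑ p ∈ S.erase p₀ \ Y, w p + w p₀ := by
      rw [Finset.erase_sdiff_comm, Finset.sum_erase_add _ _ (Finset.mem_sdiff.2 ⟨hp₀, hp₀Y⟩)]
    rw [hsum]
    linarith [hv, hYb, hcnt]

/-- **C6a1 — core extraction (provable now; the `k`-core peeling of the shell graph).** For every
`θ₁ > 0`, radius `L`, width `R` and finite configuration there is an index set `Y` (the core) such that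
every `p ∈ Y` has MORE than `θ₁ ·` (particles within `L` of `x p`) shell-partners inside `Y`, while the
ordered shell pairs not inside `Y × Y` number at most `2 θ₁ ·` (ordered pairs at distance `≤ L`):
repeatedly delete a particle violating the core condition; each deletion discards at most `θ₁ w_p`
shell pairs in each order. [folklore] -/
theorem stub_coreExtraction :
    ∀ (θ₁ L R : ℝ), 0 < θ₁ → ∀ (N : ℕ) (x : Fin N → E3), ∃ Y : Finset (Fin N),
      (∀ p ∈ Y, θ₁ * ((Finset.univ.filter fun q : Fin N => dist (x q) (x p) ≤ L).card : ℝ) <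
          ((Y.filter fun q : Fin N => L - R < dist (x q) (x p) ∧ dist (x q) (x p) ≤ L).card : ℝ)) ∧
      ((Finset.univ.filter fun p : Fin N × Fin N =>
          L - R < dist (x p.1) (x p.2) ∧ dist (x p.1) (x p.2) ≤ L).card : ℝ) ≤
        (((Y ×ˢ Y).filter fun p : Fin N × Fin N =>
            L - R < dist (x p.1) (x p.2) ∧ dist (x p.1) (x p.2) ≤ L).card : ℝ) +
          2 * θ₁ * ((Finset.univ.filter fun p : Fin N × Fin N => dist (x p.1) (x p.2) ≤ L).card : ℝ) := by
  intro θ₁ L R hθ N x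
  -- symmetry of the shell relation
  have hsymm : ∀ a b : Fin N, (L - R < dist (x a) (x b) ∧ dist (x a) (x b) ≤ L) →
      (L - R < dist (x b) (x a) ∧ dist (x b) (x a) ≤ L) := fun a b h => by rwa [dist_comm]
  obtain ⟨Y, -, hYa, hYb⟩ := coreExtraction_peel
    (fun q p : Fin N => L - R < dist (x q) (x p) ∧ dist (x q) (x p) ≤ L) hsymm
    (fun p : Fin N => ((Finset.univ.filter fun q : Fin N => dist (x q) (x p) ≤ L).card : ℝ)) θ₁
    _ Finset.univ rfl
  refine ⟨Y, hYa, ?_⟩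
  rw [Finset.univ_product_univ] at hYb
  -- the discarded weights are at most all the weights, which count the ordered pairs at distance `≤ L`
  have hsum :
      ∑ p ∈ Finset.univ \ Y, ((Finset.univ.filter fun q : Fin N => dist (x q) (x p) ≤ L).card : ℝ) ≤
        ((Finset.univ.filter fun p : Fin N × Fin N => dist (x p.1) (x p.2) ≤ L).card : ℝ) := by
    rw [← glueC5_sum_card_dist x (fun d => d ≤ L)]
    exact Finset.sum_le_univ_sum_of_nonneg fun _ => Nat.cast_nonneg _
  have h2 :
      2 * θ₁ * ∑ p ∈ Finset.univ \ Y,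
          ((Finset.univ.filter fun q : Fin N => dist (x q) (x p) ≤ L).card : ℝ) ≤
        2 * θ₁ * ((Finset.univ.filter fun p : Fin N × Fin N => dist (x p.1) (x p.2) ≤ L).card : ℝ) :=
    mul_le_mul_of_nonneg_left hsum (by positivity)
  exact hYb.trans (add_le_add le_rfl h2)

end Summit.AtomisticToContinuum.Crystallization.Theorems.LjLaminarWindowsSketch

end
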